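import Literature.Probability.LatticeModels.BoxGraphs
import Literature.Probability.LatticeModels.MagnetizationContinuity
import Literature.Probability.LatticeModels.RandomCurrents
import Literature.Probability.LatticeModels.IsingMonotonicity
import Literature.Probability.LatticeModels.GKSInequalities
import HarnessLib

/-!
# The ADS double random current in a box, and the random-current heart of ADS15 Thm. 1.2

Trunk G02 (T-STATMECH), topic `Probability/LatticeModels`; namespaces `Literature.StatMech`
(definitions) and `Literature.CritIsing` (named facts and the reduction). Third layer of the
decomposition of the named fact `Literature.Probability.LatticeModels.spontaneousMagnetization_criticalBeta_eq_zero`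
(`Sharpness.lean`): after `MagnetizationContinuity.lean`, `LroInfraredBound.lean` and
`TorusZeroMode.lean`, the only input of `m*(β_c) = 0` (`d ≥ 3`) that is not a classical tree
fact is `Literature.Probability.LatticeModels.plusPair_eq_freePair_of_lroTildeSq` — "`M̃_LRO(β) = 0 ⇒ ⟨σ_xσ_y⟩⁺_β =
⟨σ_xσ_y⟩⁰_β`", the random-current heart of

* M. Aizenman, H. Duminil-Copin, V. Sidoravicius, *Random currents and continuity of Ising
  model's spontaneous magnetization*, Comm. Math. Phys. **334** (2015) 719–742, §§2–3 (bib key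
  `AizenmanDuminilCopinSidoraviciusCMP2015`, "ADS15"; **equation numbers are those of
  arXiv:1311.1937v3**, held in the literature store).

This file splits the heart along the printed argument (§3.2) into two named facts about one new
object, the finite-volume **double random current** `ℙ_{Λ_L,β} = P⁰_{Λ_L,β} ⊗ P⁺_{Λ_L,β}`
(law of the trace of the sum of a sourceless free current and a sourceless `+` current in the
box `Λ_L`, ADS15 §2.3 and (3.1)), and proves the heart from them:

* `ads_gammaBound` — ADS15 (3.10), the **finite-volume** bound
  `⟨σ_xσ_y⟩⁺_{Λ_L,β} - ⟨σ_xσ_y⟩⁰_{Λ_L,β} ≤ Γ_{x,y}⁻¹ ℙ_{Λ_L,β}[x ↔ δ]` (switching lemma (3.6)–(3.7)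
  and the insertion map (3.8)–(3.9)); a statement about finite sums, provable from the
  random-current representation and the switching lemma;
* `ads_exitProb_tendsto_zero_of_lroTildeSq` — ADS15 Thm. 3.1 (`M̃_LRO(β) = 0 ⇒ ℙ_β[0 ↔ ∞] = 0`,
  via Thm. 2.5, uniqueness of the infinite cluster) combined with Thm. 2.3 (existence R1 and
  translation invariance R2 of the infinite-volume double current) and the limit remark after
  (3.11), in the finite-volume reading `limsup_L ℙ_{Λ_L,β}[x ↔ δ] = 0`; this is the deep input
  (infinite-volume random currents, ergodicity, Burton–Keane);
* `plusPair_eq_freePair_of_lroTildeSq_of_currents` — **the heart from these two facts**, the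
  first Griffiths comparison `⟨σ_xσ_y⟩⁰_Λ ≤ ⟨σ_xσ_y⟩⁺_Λ` (proved here from GKS II,
  `isingCorr_free_le_plus_of_gks`) and the existence of the plus and free states; the primed
  form `plusPair_eq_freePair_of_lroTildeSq_of_currents'` feeds in the discharged tree facts
  `gks_two_holds`, `hasBoxLimit_isingCorr_plus_holds`, `hasBoxLimit_isingCorr_free_holds`
  (`GKSInequalities.lean`), so that **the heart follows from the two named facts alone**.

## The double current without a ghost vertex

ADS15 realise the `+` boundary condition on `Λ = Λ_L` by a ghost site `δ` coupled to `x ∈ Λ`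
with `J_{x,δ} = #{y ∉ Λ : y ∼ x}` (§2.1, (2.8)). Equivalently (the `(βJ_{x,δ})^n/n!` weight of a
ghost bond is the multinomial convolution of `J_{x,δ}` unit bonds) one keeps the actual outer
boundary vertices `y ∈ ∂ᵉˣΛ`, whose spins are frozen to `+1`, and expands over currents on the
edge set `ℰ^b_Λ` (edges touching `Λ`) with the source constraint imposed **only at the vertices
of `Λ`** (the parity at a frozen boundary vertex is free) — this is the form used in
Duminil-Copin, *Lectures on the Ising and Potts models*, arXiv:1707.00520, §4.3, (4.5) and the
definition of `𝐏⁺_{G,β}`. Under this correspondence "`x ↔ δ`" is "`x` is joined by an open path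
to a vertex outside `Λ`" (`exitConn`), and events about bonds inside `Λ` are unchanged. We use
this ghost-free form: both currents live on the vertex type `↥Λ_{L+1}`, the free one on the graph
`freeBoxGraph` (bonds inside `Λ_L`), the plus one on `plusBoxGraph` (bonds touching `Λ_L`), so
that the tree's `Current`, `Current.sources`, `Current.weight`, `Current.traced`
(`RandomCurrents.lean`) apply verbatim; the trace of the sum (`= union of the traces`,
`Current.traced_add`) is read in `BondConfig (Site d)`.

## Contents

Definitions (`Literature.Probability.LatticeModels`): `BoxVertex d L = ↥Λ_{L+1}`, `freeBoxGraph`,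
`plusBoxGraph` (definitional aliases of `BoxGraphs.Vertex` / `BoxGraphs.free` / `BoxGraphs.plus` of the
import-light module `BoxGraphs.lean`, kept under these names for the importers of this file),
`adsPairWeight` (`𝟙{∂n₁ = ∅} 𝟙{∂n₂ ∩ Λ_L = ∅} w_β(n₁) w_β(n₂)`), `adsPairNorm` (its sum),
`liftBonds`, `adsDoubleCurrentLaw d L β` (the probability measure `ℙ_{Λ_L,β}` on
`BondConfig (Site d)`, an explicit normalised sum of Dirac masses as in `doubleCurrentMeasure`;
junk `0` if the normaliser vanishes, meaningless for `β < 0`), `exitConn d L x` (the event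
`x ↔ δ`), `l1Dist`.

Proved (`Literature.CritIsing`): `isingCorr_free_le_plus_of_gks` (Griffiths' comparison
`⟨σ_A⟩⁰_Λ ≤ ⟨σ_A⟩⁺_Λ`, `β, h ≥ 0`, from `gks_two` by the boundary-field tilt of Friedli–Velenik
2017, proof of Lemma 3.23, expanded into a ferromagnetic polynomial), `isingExpect_plus_eq_free_of_beta_zero`,
and the reduction `plusPair_eq_freePair_of_lroTildeSq_of_currents`.

## Mathlib status

No random currents in Mathlib. Anchors: `Measure.sum`, `Measure.dirac`, `tsum`,
`Finset.prod_one_add` (expansion of `∏ (1 + t σ_B)`), `Real.cosh_add_sinh`/`Real.tanh_eq_sinh_div_cosh`,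
`le_of_tendsto_of_tendsto'`, `ge_of_tendsto`.
-/

noncomputable section

open MeasureTheory Filter Topology Finset Literature.Probability.LatticeModels Literature.Probability.Percolation
open scoped symmDiff

namespace Literature.Probability.LatticeModels

variable (d : ℕ)

/-! ### The two finite graphs carrying the free and the plus currents of the box `Λ_L`

The graph vocabulary lives in the import-light module `BoxGraphs.lean` (`BoxGraphs.Vertex`,
`BoxGraphs.free`, `BoxGraphs.plus`); the names below are kept, with their original statements,
as definitional aliases of those (every importer of this file uses them), pending an operator
dedup. They are `def`s unfolding in one step to the `BoxGraphs` objects (not `abbrev`s, so that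
the reducible-transparency keys of the importers' instances and lemmas are unchanged). -/

/-- The vertex type `↥Λ_{L+1}` (the box `Λ_L` together with its outer vertex boundary, and a
few isolated corner vertices) on which both currents of the box `Λ_L` live; the same type as
`BoxGraphs.Vertex d L`. [cite: AizenmanDuminilCopinSidoraviciusCMP2015, §2.1] -/
abbrev BoxVertex (L : ℕ) : Type := ↥(box d (L + 1))

/-- The graph of the **free** system in `Λ_L`: nearest-neighbour bonds with both endpoints in
`Λ_L` (`ℰ_{Λ_L}`; ADS15 §2.1, currents on `Ω_{Λ_L}` for (2.7)). Alias of `BoxGraphs.free d L`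
(`BoxGraphs.lean`), kept for the importers of this file. [cite: AizenmanDuminilCopinSidoraviciusCMP2015, §2.1, eq. (2.7)] -/
def freeBoxGraph (L : ℕ) : SimpleGraph (BoxVertex d L) := BoxGraphs.free d L

/-- The graph of the **plus** system in `Λ_L`: nearest-neighbour bonds with at least one
endpoint in `Λ_L` (`ℰ^b_{Λ_L}`), the other endpoint possibly a frozen boundary vertex of
`∂ᵉˣΛ_L ⊂ Λ_{L+1}` (the ghost-free form of ADS15 §2.1, (2.8): the ghost bond `{x,δ}` of coupling
`J_{x,δ} = #{y ∉ Λ_L : y ∼ x}` is resolved into the unit bonds `{x,y}`). Alias of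
`BoxGraphs.plus d L` (`BoxGraphs.lean`), kept for the importers of this file. [cite: AizenmanDuminilCopinSidoraviciusCMP2015, §2.1, eq. (2.8)] -/
def plusBoxGraph (L : ℕ) : SimpleGraph (BoxVertex d L) := BoxGraphs.plus d L

/-- Adjacency in the free box graph is decidable (needed for `edgeFinset`, hence for the
tree's `Current`). [folklore] -/
instance (L : ℕ) : DecidableRel (freeBoxGraph d L).Adj := fun _ _ =>
  inferInstanceAs (Decidable (_ ∧ _))

/-- Adjacency in the plus box graph is decidable. [folklore] -/
instance (L : ℕ) : DecidableRel (plusBoxGraph d L).Adj := fun _ _ =>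
  inferInstanceAs (Decidable (_ ∧ _))

/-- Adjacency in the free box graph, unfolded. [cite: AizenmanDuminilCopinSidoraviciusCMP2015, §2.1, eq. (2.7)] -/
theorem freeBoxGraph_adj {L : ℕ} (a b : BoxVertex d L) :
    (freeBoxGraph d L).Adj a b ↔
      (zdGraph d).Adj a.1 b.1 ∧ (a : Site d) ∈ box d L ∧ (b : Site d) ∈ box d L :=
  Iff.rfl

/-- Adjacency in the plus box graph, unfolded. [cite: AizenmanDuminilCopinSidoraviciusCMP2015, §2.1, eq. (2.8)] -/
theorem plusBoxGraph_adj {L : ℕ} (a b : BoxVertex d L) :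
    (plusBoxGraph d L).Adj a b ↔
      (zdGraph d).Adj a.1 b.1 ∧ ((a : Site d) ∈ box d L ∨ (b : Site d) ∈ box d L) :=
  Iff.rfl

/-- The free bonds are plus bonds: `ℰ_{Λ_L} ⊆ ℰ^b_{Λ_L}`. [cite: AizenmanDuminilCopinSidoraviciusCMP2015, §2.1] -/
theorem freeBoxGraph_le_plusBoxGraph (L : ℕ) : freeBoxGraph d L ≤ plusBoxGraph d L :=
  fun _ _ h => ⟨h.1, Or.inl h.2.1⟩

/-- The alias unfolds to the `BoxGraphs` object (definitional, `rfl`). [folklore] -/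
theorem freeBoxGraph_eq (L : ℕ) : freeBoxGraph d L = BoxGraphs.free d L := rfl

/-- The alias unfolds to the `BoxGraphs` object (definitional, `rfl`). [folklore] -/
theorem plusBoxGraph_eq (L : ℕ) : plusBoxGraph d L = BoxGraphs.plus d L := rfl

/-! ### The double current `ℙ_{Λ_L,β} = P⁰_{Λ_L,β} ⊗ P⁺_{Λ_L,β}` -/

/-- The weight of a pair (free current `n₁`, plus current `n₂`) in the double current of the box
`Λ_L`: `𝟙{∂n₁ = ∅} 𝟙{∂n₂ ⊆ ∂ᵉˣΛ_L} w_β(n₁) w_β(n₂)` — the plus current may have sources only at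
frozen boundary vertices (the ghost-free form of "`∂n₂ = ∅` on `Λ_L ∪ {δ}`", ADS15 (3.1) and
§2.3, definition of `ℙ_β` / `ℙ_{Λ_n,β}` in the proof of Lemma 2.6). [cite: AizenmanDuminilCopinSidoraviciusCMP2015, §3.1, eq. (3.1)] -/
def adsPairWeight (L : ℕ) (β : ℝ)
    (p : Current (freeBoxGraph d L) × Current (plusBoxGraph d L)) : ℝ :=
  if p.1.sources = ∅ ∧ ∀ v ∈ p.2.sources, (v : Site d) ∉ box d L then
    p.1.weight β * p.2.weight β else 0

/-- Pair weights are nonnegative for `β ≥ 0`. [cite: AizenmanDuminilCopinSidoraviciusCMP2015, §3.1, eq. (3.1)] -/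
theorem adsPairWeight_nonneg (L : ℕ) {β : ℝ} (hβ : 0 ≤ β)
    (p : Current (freeBoxGraph d L) × Current (plusBoxGraph d L)) :
    0 ≤ adsPairWeight d L β p := by
  unfold adsPairWeight
  split_ifs
  · exact mul_nonneg (Current.weight_nonneg hβ _) (Current.weight_nonneg hβ _)
  · exact le_rfl

/-- The normaliser `Z⁰(Λ_L) Z⁺(Λ_L) / 4^{|Λ_L|}` of the double current: the sum of all pair
weights (ADS15 (3.1), denominator). [cite: AizenmanDuminilCopinSidoraviciusCMP2015, §3.1, eq. (3.1)] -/
def adsPairNorm (L : ℕ) (β : ℝ) : ℝ :=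
  ∑' p : Current (freeBoxGraph d L) × Current (plusBoxGraph d L), adsPairWeight d L β p

/-- Reading a bond configuration of `↥Λ_{L+1}` as a bond configuration of `ℤ^d` (bonds not
inside `Λ_{L+1}` closed). [folklore] -/
def liftBonds (L : ℕ) (ω : BondConfig (BoxVertex d L)) : BondConfig (Site d) :=
  Sym2.map Subtype.val '' ω

/-- **The double random current of the box `Λ_L`**: the law `ℙ_{Λ_L,β}` on bond configurations
of `ℤ^d` of the trace `\widehat{n₁ + n₂}` (`= n̂₁ ∪ n̂₂`, `Current.traced_add`) of a free
current `n₁` on `Λ_L` with `∂n₁ = ∅` and an independent plus current `n₂` on `ℰ^b_{Λ_L}` with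
no sources in `Λ_L`, with probabilities proportional to `w_β(n₁) w_β(n₂)` (ADS15 §2.3 and (3.1):
`P⁰_{Λ_L,β} ⊗ P⁺_{Λ_L,β}`, the finite-volume measure `ℙ_{Λ_n,β}` of the proof of Lemma 2.6; here in
the ghost-free form, see the module docstring). Written, as the tree's `doubleCurrentMeasure`,
as an explicit normalised sum of Dirac masses; **junk**: the zero measure if the normaliser
`adsPairNorm` vanishes (it does not for `β ≥ 0`: the zero currents contribute `1`; but its
finiteness = summability is not proved here), and meaningless for `β < 0` (`ENNReal.ofReal`
truncates negative weights). [cite: AizenmanDuminilCopinSidoraviciusCMP2015, §2.3 and §3.1, eq. (3.1)] -/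
def adsDoubleCurrentLaw (L : ℕ) (β : ℝ) : Measure (BondConfig (Site d)) :=
  Measure.sum fun p : Current (freeBoxGraph d L) × Current (plusBoxGraph d L) =>
    ENNReal.ofReal (adsPairWeight d L β p / adsPairNorm d L β) •
      Measure.dirac (liftBonds d L (p.1.traced ∪ p.2.traced))

/-- The event "`x ↔ δ`" of ADS15 (3.7)–(3.10) in the ghost-free form: `x` is joined by an open
path to some vertex outside `Λ_L` (a frozen boundary vertex). [cite: AizenmanDuminilCopinSidoraviciusCMP2015, §3.2, eq. (3.7)] -/
def exitConn (L : ℕ) (x : Site d) : Set (BondConfig (Site d)) :=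
  {ω | ∃ y : Site d, y ∉ box d L ∧ ω ∈ openConn x y}

/-- Membership in the exit event. [cite: AizenmanDuminilCopinSidoraviciusCMP2015, §3.2, eq. (3.7)] -/
theorem mem_exitConn_iff {L : ℕ} {x : Site d} {ω : BondConfig (Site d)} :
    ω ∈ exitConn d L x ↔ ∃ y : Site d, y ∉ box d L ∧ (openGraph ω).Reachable x y :=
  Iff.rfl

/-- The exit event is monotone in the configuration (opening bonds preserves open paths). [folklore] -/
theorem exitConn_mono {L : ℕ} {x : Site d} {ω ω' : BondConfig (Site d)} (hle : ω ⊆ ω')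
    (hω : ω ∈ exitConn d L x) : ω' ∈ exitConn d L x := by
  obtain ⟨y, hy, hxy⟩ := hω
  refine ⟨y, hy, hxy.mono ?_⟩
  intro a b hab
  rw [openGraph_adj] at hab ⊢
  exact ⟨hle hab.1, hab.2⟩

/-- The graph (`ℓ¹`) distance on `ℤ^d`, `‖x - y‖₁ = ∑ᵢ |xᵢ - yᵢ|`, the length of a shortest
nearest-neighbour path from `x` to `y` (ADS15 (3.8): the path `x = x_0, …, x_m = y`). [cite: AizenmanDuminilCopinSidoraviciusCMP2015, §3.2, eq. (3.8)] -/
def l1Dist (x y : Site d) : ℕ := ∑ i, (x i - y i).natAbs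

/-- `‖x - x‖₁ = 0`. [folklore] -/
@[simp] theorem l1Dist_self (x : Site d) : l1Dist d x x = 0 := by
  simp [l1Dist]

/-- `‖x - y‖₁ = ‖y - x‖₁`. [folklore] -/
theorem l1Dist_comm (x y : Site d) : l1Dist d x y = l1Dist d y x := by
  unfold l1Dist
  exact Finset.sum_congr rfl fun i _ => by rw [← Int.natAbs_neg, neg_sub]

end Literature.Probability.LatticeModels

namespace Literature.Probability.LatticeModels

open Percolation

variable {d : ℕ}

/-! ### The two named facts -/

/-- **ADS15 eq. (3.10)** (Aizenman–Duminil-Copin–Sidoravicius, CMP 334 (2015), §3.2,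
arXiv v3 (3.6)–(3.10): by the switching lemma,
`⟨σ_xσ_y⟩⁺_{Λ_L,β} - ⟨σ_xσ_y⟩⁰_{Λ_L,β} = (Z⁰Z⁺)⁻¹ ∑_{∂n₁=∅, ∂n₂={x,y}} w w (1 - 𝟙[x ↔ y in Λ_L])
≤ (Z⁰Z⁺)⁻¹ ∑_{∂n₁=∅, ∂n₂={x,y}} w w 𝟙[x ↔ δ]` (3.6)–(3.7), and the one-to-many insertion map
along a path `x = x_0, …, x_m = y` inside `Λ_L`, which resets `∂n₂` to `∅` at cost
`Γ_{x,y} = ∏_j min{tanh(βJ_{e_j}), (cosh(βJ_{e_j}) - 1)/sinh(βJ_{e_j})}` (3.8)–(3.9), give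
`⟨σ_xσ_y⟩⁺_{Λ_L,β} - ⟨σ_xσ_y⟩⁰_{Λ_L,β} ≤ Γ_{x,y}⁻¹ P⁰_{Λ_L,β} ⊗ P⁺_{Λ_L,β}[x ↔ δ]` (3.10)).
Nearest-neighbour model on `ℤ^d`, `β > 0`, `x, y ∈ Λ_L`: taking for the path a shortest lattice
path (which stays in the box), `Γ_{x,y} = tanh(β/2)^{‖x-y‖₁}` (`J ≡ 1`,
`(cosh β - 1)/sinh β = tanh(β/2) ≤ tanh β`), and `x ↔ δ` is `exitConn` (ghost-free form). A
finite-volume statement about finite sums of current weights (to be proved from the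
random-current representation (2.7)–(2.8) and the switching lemma, Lemma 2.2). [cite: AizenmanDuminilCopinSidoraviciusCMP2015, §3.2, eq. (3.10)] -/
def ads_gammaBound : Prop :=
  ∀ ⦃β : ℝ⦄, 0 < β → ∀ (L : ℕ) ⦃x y : Site d⦄, x ∈ box d L → y ∈ box d L →
    isingTwoPoint (zdGraph d) (box d L) β 0 .plus x y -
        isingTwoPoint (zdGraph d) (box d L) β 0 .free x y ≤
      (Real.tanh (β / 2) ^ l1Dist d x y)⁻¹ * (adsDoubleCurrentLaw d L β).real (exitConn d L x)

/-- **ADS15 Thm. 3.1 with Thm. 2.3, finite-volume reading** (Aizenman–Duminil-Copin–Sidoravicius,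
CMP 334 (2015): Thm. 3.1 "For `β` at which `M̃_LRO(β) = 0`, also `ℙ_β[0 ↔ ∞] = 0`" — proved from
the switching identity (3.2)–(3.3), Cauchy–Schwarz (3.4) and the uniqueness of the infinite
cluster, Thm. 2.5 (Burton–Keane with the insertion tolerance Lemma 2.6); Thm. 2.3: the
infinite-volume double current `ℙ_β` is the limit of `ℙ_{Λ_L,β}` on local events (R1) and is
translation invariant (R2), so `ℙ_β[x ↔ ∞] = ℙ_β[0 ↔ ∞]`; and the parenthetical remark after
(3.11): `limsup_L ℙ_{Λ_L,β}[x ↔ δ] ≤ inf_N ℙ_β[x ↔ ∂(x + Λ_N)] = ℙ_β[x ↔ ∞]`, "justifying passing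
to the limit … by first considering the events that `x` is connected to distance `N`").
Nearest-neighbour model on `ℤ^d` (it satisfies C1–C4), `β > 0`: if `M̃_LRO(β)² = 0`
(`lroTildeSq d β = 0`) then for every site `x`, `ℙ_{Λ_L,β}[x ↔ δ] → 0` as `L → ∞`, in `ε`-form.
This is the deep input of ADS15 (infinite-volume random currents, ergodicity, uniqueness of the
infinite cluster). [cite: AizenmanDuminilCopinSidoraviciusCMP2015, Thm. 3.1 with Thm. 2.3 and §3.2, remark after (3.11)] -/
def ads_exitProb_tendsto_zero_of_lroTildeSq : Prop :=
  ∀ ⦃β : ℝ⦄, 0 < β → lroTildeSq d β = 0 → ∀ (x : Site d), ∀ ε > 0, ∃ L₀ : ℕ, ∀ L : ℕ, L₀ ≤ L →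
    (adsDoubleCurrentLaw d L β).real (exitConn d L x) ≤ ε

/-! ### Griffiths' comparison `⟨σ_A⟩⁰_Λ ≤ ⟨σ_A⟩⁺_Λ` from GKS II -/

section FreeLePlus

variable {V : Type*} [DecidableEq V] (G : SimpleGraph V) [G.LocallyFinite]

omit [DecidableEq V] in
/-- `exp(β s) = cosh β + sinh β · s` for `s = ±1`. [folklore] -/
theorem exp_mul_eq_cosh_add_sinh_mul {s : ℝ} (hs : s * s = 1) (β : ℝ) :
    Real.exp (β * s) = Real.cosh β + Real.sinh β * s := by
  rcases mul_self_eq_one_iff.1 hs with rfl | rfl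
  · rw [mul_one, mul_one, Real.cosh_add_sinh]
  · rw [mul_neg_one, mul_neg_one, ← sub_eq_add_neg, Real.cosh_sub_sinh]

/-- For a non-diagonal pair, the bond observable read from inside `Λ` is the spin product over
the endpoints lying in `Λ`. [folklore] -/
theorem bondSpinIn_eq_spinProduct_filter (Λ : Finset V) (σ : SpinConfig V) {e : Sym2 V}
    (he : ¬e.IsDiag) :
    bondSpinIn Λ σ e = spinProduct (e.toFinset.filter (· ∈ Λ)) σ := by
  induction e using Sym2.ind with
  | _ a b =>
    rw [Sym2.mk_isDiag_iff] at he
    rw [bondSpinIn_mk, Sym2.toFinset_mk_eq, Finset.filter_insert, Finset.filter_singleton]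
    by_cases ha : a ∈ Λ <;> by_cases hb : b ∈ Λ <;>
      simp [ha, hb, spinProduct, Finset.prod_pair he]

/-- Products of spin products are spin products: `∏_{i ∈ F} σ_{B i} = σ_{∆_{i ∈ F} B i}`. [folklore] -/
theorem prod_spinProduct_eq_spinProduct_fold {ι : Type*} [DecidableEq ι] (F : Finset ι)
    (B : ι → Finset V) (σ : SpinConfig V) :
    ∏ i ∈ F, spinProduct (B i) σ =
      spinProduct (F.fold (fun s t : Finset V => s ∆ t) (∅ : Finset V) B) σ := by
  induction F using Finset.induction_on with
  | empty => simp [spinProduct]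
  | insert i F hi ih => rw [Finset.prod_insert hi, Finset.fold_insert hi, ih, spinProduct_mul_spinProduct]

/-- The folded set lies in the union. [folklore] -/
theorem fold_symmDiff_subset_biUnion {ι : Type*} [DecidableEq ι] (F : Finset ι)
    (B : ι → Finset V) :
    F.fold (fun s t : Finset V => s ∆ t) (∅ : Finset V) B ⊆ F.biUnion B := by
  induction F using Finset.induction_on with
  | empty => simp
  | insert i F hi ih =>
    rw [Finset.fold_insert hi, Finset.biUnion_insert]
    exact (Finset.symmDiff_subset_union).trans (Finset.union_subset_union le_rfl ih)

/-- **The boundary factor is a ferromagnetic polynomial**: for `β ≥ 0`,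
`I(σ) = exp(β ∑_{e ∈ ∂Λ} σ_e^{in}) = (cosh β)^{|∂Λ|} ∑_{F ⊆ ∂Λ} (tanh β)^{|F|} σ_{B(F)}` with
`B(F) ⊆ Λ` (the expansion `e^{βσ} = cosh β (1 + σ tanh β)` of Friedli–Velenik 2017, §3.7.3,
applied to the factor `I` of the proof of Lemma 3.23). [cite: FriedliVelenik2017, §3.6.2, proof of Lemma 3.23] -/
theorem plusBoundaryFactor_eq_sum (Λ : Finset V) (β : ℝ) (σ : SpinConfig V) :
    plusBoundaryFactor G Λ β σ =
      ∑ F ∈ (edgeBoundary G Λ).powerset,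
        Real.cosh β ^ #(edgeBoundary G Λ) * Real.sinh β ^ #F / Real.cosh β ^ #F *
          spinProduct (F.fold (fun s t : Finset V => s ∆ t) (∅ : Finset V)
            (fun e => e.toFinset.filter (· ∈ Λ))) σ := by
  set D := edgeBoundary G Λ with hD
  set B : Sym2 V → Finset V := fun e => e.toFinset.filter (· ∈ Λ) with hB
  have hnd : ∀ e ∈ D, ¬e.IsDiag := fun e he =>
    SimpleGraph.not_isDiag_of_mem_edgeSet _ ((mem_edgeBoundary_iff.1 he).1)
  have hcosh : Real.cosh β ≠ 0 := (Real.cosh_pos β).ne'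
  -- `I = ∏_e (cosh β + sinh β σ_{B e})`
  have h1 : plusBoundaryFactor G Λ β σ = ∏ e ∈ D, (Real.cosh β + Real.sinh β * spinProduct (B e) σ) := by
    rw [plusBoundaryFactor, Finset.mul_sum, Real.exp_sum]
    refine Finset.prod_congr rfl fun e he => ?_
    rw [bondSpinIn_eq_spinProduct_filter Λ σ (hnd e he)]
    exact exp_mul_eq_cosh_add_sinh_mul (spinProduct_mul_self (B e) σ) β
  -- factor `cosh β` out of each term and expand
  have h2 : ∏ e ∈ D, (Real.cosh β + Real.sinh β * spinProduct (B e) σ) =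
      Real.cosh β ^ #D * ∏ e ∈ D, (1 + Real.sinh β / Real.cosh β * spinProduct (B e) σ) := by
    rw [← Finset.prod_const, ← Finset.prod_mul_distrib]
    refine Finset.prod_congr rfl fun e _ => ?_
    field_simp
  rw [h1, h2, Finset.prod_one_add, Finset.mul_sum]
  refine Finset.sum_congr rfl fun F hF => ?_
  rw [Finset.prod_mul_distrib, Finset.prod_const, prod_spinProduct_eq_spinProduct_fold, div_pow]
  ring

/-- **Griffiths' comparison of free and plus boundary conditions, from GKS II**
(Friedli–Velenik 2017, Exercise 3.12, hint in App. C: "add a magnetic field `h'` acting on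
spins in `Λ₂ ∖ Λ₁`, and let `h' → ∞`"; here directly: the `+` weights are the free weights tilted
by the ferromagnetic polynomial `I` of the proof of Lemma 3.23, and GKS II gives
`⟨σ_A⟩⁰⟨I⟩⁰ ≤ ⟨σ_A I⟩⁰`). For any locally finite graph, `β ≥ 0`, `h ≥ 0`, `A ⊆ Λ`:
`⟨σ_A⟩⁰_{Λ;β,h} ≤ ⟨σ_A⟩⁺_{Λ;β,h}`, granting the tree fact `gks_two` for the graph. [cite: FriedliVelenik2017, Exercise 3.12] -/
theorem isingCorr_free_le_plus_of_gks
    (hgks : ∀ (Λ A B : Finset V) (β h : ℝ) (bc : BoundaryCondition V),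
      gks_two G (Λ := Λ) (A := A) (B := B) (β := β) (h := h) (bc := bc))
    {β h : ℝ} (hβ : 0 ≤ β) (hh : 0 ≤ h) {Λ A : Finset V} (hA : A ⊆ Λ) :
    isingCorr G Λ β h .free A ≤ isingCorr G Λ β h .plus A := by
  classical
  set D := edgeBoundary G Λ with hD
  set B : Sym2 V → Finset V := fun e => e.toFinset.filter (· ∈ Λ) with hB
  set c : Finset (Sym2 V) → ℝ := fun F =>
    Real.cosh β ^ #D * Real.sinh β ^ #F / Real.cosh β ^ #F with hc
  set Bf : Finset (Sym2 V) → Finset V := fun F =>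
    F.fold (fun s t : Finset V => s ∆ t) (∅ : Finset V) B with hBf
  have hR := measurable_plusBoundaryFactor G Λ β
  have hRW : plusBoundaryFactor G Λ β = fun σ => ∑ F ∈ D.powerset, c F * spinProduct (Bf F) σ := by
    funext σ
    exact plusBoundaryFactor_eq_sum G Λ β σ
  have hc_nonneg : ∀ F ∈ D.powerset, 0 ≤ c F := fun F _ => by
    have h1 : 0 ≤ Real.cosh β := (Real.cosh_pos β).le
    have h2 : 0 ≤ Real.sinh β := Real.sinh_nonneg_iff.2 hβ
    positivity
  have hBsub : ∀ F ∈ D.powerset, Bf F ⊆ Λ := fun F _ =>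
    (fold_symmDiff_subset_biUnion F B).trans
      (Finset.biUnion_subset.2 fun e _ x hx => (Finset.mem_filter.1 hx).2)
  -- the tilting identity and GKS II
  have htilt := isingExpect_eq_div_of_isingWeight_eq G (bc₁ := .free) (bc₂ := .plus) rfl hR
    (isingWeight_plus_eq G Λ β h) (measurable_spinProduct A)
  have hpos : 0 < isingExpect G Λ β h .free (plusBoundaryFactor G Λ β) :=
    isingExpect_pos G Λ β h .free hR (plusBoundaryFactor_pos G Λ β)
  have hgks' := isingCorr_mul_isingExpect_sum_le G hgks hβ hh (Or.inl rfl) hA D.powerset c Bf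
    hc_nonneg hBsub
  have heq : (fun σ => spinProduct A σ * ∑ F ∈ D.powerset, c F * spinProduct (Bf F) σ) =
      fun σ => spinProduct A σ * plusBoundaryFactor G Λ β σ := by
    funext σ; rw [hRW]
  rw [← hRW, heq] at hgks'
  change isingCorr G Λ β h .free A ≤ isingExpect G Λ β h .plus (spinProduct A)
  rw [htilt, le_div_iff₀ hpos]
  exact hgks'

end FreeLePlus

/-! ### `β = 0`: the boundary condition is invisible -/

/-- At `β = 0` all Boltzmann weights are `1` and the glued configurations of the free and the
plus boundary condition coincide, so `⟨f⟩⁺_{Λ;0,h} = ⟨f⟩⁰_{Λ;0,h}`. [folklore] -/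
theorem isingExpect_plus_eq_free_of_beta_zero {V : Type*} [DecidableEq V] (G : SimpleGraph V)
    [G.LocallyFinite] (Λ : Finset V) (h : ℝ) {f : SpinConfig V → ℝ} (hf : Measurable f) :
    isingExpect G Λ 0 h .plus f = isingExpect G Λ 0 h .free f := by
  have hw : ∀ (bc : BoundaryCondition V) (τ : Λ → ℤˣ), isingWeight G Λ 0 h bc τ = 1 := by
    intro bc τ; simp [isingWeight]
  rw [isingExpect_eq_sum_div G Λ h .plus 0 hf, isingExpect_eq_sum_div G Λ h .free 0 hf]
  simp only [isingPartitionFunction, hw, one_mul, glue_free_eq_glue_plus]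

/-! ### The heart from the two facts -/

/-- **The random-current heart of ADS15 Thm. 1.2 from its two halves.** The named fact
`plusPair_eq_freePair_of_lroTildeSq` (`M̃_LRO(β) = 0 ⇒ ⟨σ_xσ_y⟩⁺_β = ⟨σ_xσ_y⟩⁰_β`,
`MagnetizationContinuity.lean`) follows from the finite-volume bound (3.10) (`ads_gammaBound`),
the vanishing of the exit probability (Thm. 3.1 with Thm. 2.3, `ads_exitProb_tendsto_zero_of_lroTildeSq`),
Griffiths' comparison `⟨σ_xσ_y⟩⁰_{Λ_L} ≤ ⟨σ_xσ_y⟩⁺_{Λ_L}` (proved above from `gks_two`) and the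
existence of the plus and free states (tree facts), exactly as in ADS15 §3.2: (3.10) and
`L → ∞` give `0 ≤ ⟨σ_xσ_y⟩⁺_β - ⟨σ_xσ_y⟩⁰_β ≤ Γ_{x,y}⁻¹ limsup_L ℙ_{Λ_L,β}[x ↔ δ] = 0` (3.11).
(Aizenman–Duminil-Copin–Sidoravicius, CMP 334 (2015), §3.2, (3.10)–(3.11).) [cite: AizenmanDuminilCopinSidoraviciusCMP2015, §3.2, eqs. (3.10)–(3.11)] -/
theorem plusPair_eq_freePair_of_lroTildeSq_of_currents
    (hΓ : ads_gammaBound (d := d))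
    (hexit : ads_exitProb_tendsto_zero_of_lroTildeSq (d := d))
    (hgks : ∀ (Λ A B : Finset (Site d)) (β h : ℝ) (bc : BoundaryCondition (Site d)),
      gks_two (zdGraph d) (Λ := Λ) (A := A) (B := B) (β := β) (h := h) (bc := bc))
    (hlimp : hasBoxLimit_isingCorr_plus d) (hlimf : hasBoxLimit_isingCorr_free d) :
    plusPair_eq_freePair_of_lroTildeSq (d := d) := by
  intro β hβ hM x y
  -- the two box limits
  have hP : Tendsto (fun L : ℕ => isingTwoPoint (zdGraph d) (box d L) β 0 .plus x y) atTop
      (𝓝 (plusPair d β x y)) := tendsto_isingExpect_plus_spinPair hlimp hβ x y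
  have hF : Tendsto (fun L : ℕ => isingTwoPoint (zdGraph d) (box d L) β 0 .free x y) atTop
      (𝓝 (freePair d β x y)) := tendsto_isingTwoPoint_free_pair hlimf hβ x y
  rcases hβ.eq_or_lt with rfl | hβpos
  · -- `β = 0`: the two finite-volume functions coincide
    refine tendsto_nhds_unique hP ?_
    have : (fun L : ℕ => isingTwoPoint (zdGraph d) (box d L) 0 0 .plus x y) =
        fun L : ℕ => isingTwoPoint (zdGraph d) (box d L) 0 0 .free x y := by
      funext L
      exact isingExpect_plus_eq_free_of_beta_zero (zdGraph d) (box d L) 0 (measurable_spinPair x y)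
    rw [this]; exact hF
  -- `β > 0`. Lower bound: free ≤ plus in every large box
  have hlow : freePair d β x y ≤ plusPair d β x y := by
    refine le_of_tendsto_of_tendsto hF hP ?_
    filter_upwards [eventually_mem_box x, eventually_mem_box y] with L hx hy
    rcases eq_or_ne x y with rfl | hxy
    · simp [isingTwoPoint_self]
    · have hsub : ({x, y} : Finset (Site d)) ⊆ box d L := by
        intro z hz
        rcases Finset.mem_insert.1 hz with rfl | hz
        · exact hx
        · rw [Finset.mem_singleton.1 hz]; exact hy
      have := isingCorr_free_le_plus_of_gks (zdGraph d) hgks hβ le_rfl hsub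
      simpa only [isingTwoPoint_eq_isingCorr _ _ _ _ _ hxy] using this
  -- upper bound: plus - free ≤ ε eventually, for every ε
  have hup : plusPair d β x y ≤ freePair d β x y := by
    set Γ : ℝ := Real.tanh (β / 2) ^ l1Dist d x y with hΓdef
    have hΓpos : 0 < Γ := by
      have : 0 < Real.tanh (β / 2) := by
        rw [Real.tanh_eq_sinh_div_cosh]
        exact div_pos (Real.sinh_pos_iff.2 (by linarith)) (Real.cosh_pos _)
      positivity
    refine le_of_forall_pos_le_add fun ε hε => ?_
    obtain ⟨L₀, hL₀⟩ := hexit hβpos hM x (Γ * ε) (mul_pos hΓpos hε)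
    refine le_of_tendsto_of_tendsto hP (hF.add_const ε) ?_
    filter_upwards [eventually_ge_atTop L₀, eventually_mem_box x, eventually_mem_box y]
      with L hL hx hy
    have h1 := hΓ hβpos L hx hy
    have h2 := hL₀ L hL
    have h3 : Γ⁻¹ * (adsDoubleCurrentLaw d L β).real (exitConn d L x) ≤ ε := by
      rw [inv_mul_le_iff₀ hΓpos]; exact h2
    linarith
  exact le_antisymm hup hlow

/-- **The heart from the two named facts alone**: as `plusPair_eq_freePair_of_lroTildeSq_of_currents`,
with GKS II and the existence of the plus and free states supplied by the discharged tree facts of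
`GKSInequalities.lean`. [cite: AizenmanDuminilCopinSidoraviciusCMP2015, §3.2, eqs. (3.10)–(3.11)] -/
theorem plusPair_eq_freePair_of_lroTildeSq_of_currents'
    (hΓ : ads_gammaBound (d := d))
    (hexit : ads_exitProb_tendsto_zero_of_lroTildeSq (d := d)) :
    plusPair_eq_freePair_of_lroTildeSq (d := d) :=
  plusPair_eq_freePair_of_lroTildeSq_of_currents hΓ hexit
    (fun _ _ _ _ _ _ => Literature.Probability.LatticeModels.GKSInequalities.gks_two_holds (zdGraph d))
    hasBoxLimit_isingCorr_plus_holds hasBoxLimit_isingCorr_free_holds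

end Literature.Probability.LatticeModels
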